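import Literature.Probability.Distributions.BrascampLiebMomentCore

/-!
# Brascamp–Lieb 1976, Theorem 5.1 (n = 1): centred absolute moments of a Gaussian times a
# log-concave factor are dominated by the Gaussian's

`Literature/Probability/Distributions/`. THEOREM 5.1 of Brascamp–Lieb (J. Funct. Anal. 22 (1976)
381–383), one-dimensional case (= Lemma 5.3), as printed: "Let `F(x)` be a nonnegative function on
`Rⁿ`, and let `A` be a real, positive definite, `n × n` matrix. Assume `exp[−(x, Ax)] F(x) ∈ L¹` and
define `⟨h⟩_F = ∫ h(x) exp[−(x, Ax)] F(x) dx / ∫ exp[−(x, Ax)] F(x) dx`. If `F(x) = 1` we write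
`⟨·⟩_1`. Let `φ ∈ Rⁿ`, `α ∈ R`. Then `⟨|(φ, x) − ⟨(φ, x)⟩_F|^α⟩_F ≤ ⟨|(φ, x)|^α⟩_1` when `F` is log
concave and `α ≥ 1`." Here: `n = 1`, `A = b > 0`, integer `α = p ≥ 1`, and the nonnegative
log-concave `F` presented as `F = 1_S e^{-H}` with `S` an interval (`Set.OrdConnected`, bounded or
not) and `H` convex on `S` (`logConcaveFactor`) — `centredAbsMoment_le_gaussian`. The recentring
step of the printed proof ("Write `⟨|x − ⟨x⟩_F|^α⟩_F = ⟨|x|^α⟩_G` with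
`G(x) = F(x + ⟨x⟩_F) exp(−2x⟨x⟩_F)`. Then `G(x)` is log concave, and `⟨x⟩_G = 0`") is carried out
here; the rest is `GaussQCData.core` (file `BrascampLiebMomentCore`).

Also: the Gaussian ratio in closed form `⟨|x|^p⟩_1 = b^{-p/2} Γ((p+1)/2)/√π`
(`gaussAbsMoment_ratio_eq`), even moments `(2j−1)‼/(2b)^j` (`gaussEvenMoment_ratio_eq`), and the
consumer form for a density `∝ 1_S e^{-g}` with `g − (ρ/2)x²` convex on `S` (e.g. `g'' ≥ ρ`):
`∫_S |x − m|^p e^{-g} / ∫_S e^{-g} ≤ E|N(0,1/ρ)|^p` (`centredAbsMoment_le_gaussian_of_convexOn`) and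
the sharp even-moment ladder `≤ (2j−1)‼/ρ^j` (`centredEvenMoment_le_doubleFactorial`) — the form in
which the inequality is used for Gaussian domination of the moments of strongly log-concave laws
(Brascamp–Lieb ladder with `c_{2j} = (2j−1)‼`). No named facts.

References: H. J. Brascamp, E. H. Lieb, On extensions of the Brunn–Minkowski and Prékopa–Leindler
theorems, including inequalities for log concave functions, and with an application to the diffusion
equation, J. Funct. Anal. 22 (1976) 366–389, Thm 5.1, Lemmas 5.2–5.3. [BrascampLieb1976]
-/

noncomputable section

open MeasureTheory Set Filter Real
open scoped Topology ENNReal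

namespace Literature.Probability.Distributions

open scoped Nat

/-! ### The log-concave factor and the recentring -/

/-- The log-concave factor `F = 1_S · e^{-H}` (`S` an interval, `H` convex on `S`): the general
nonnegative log-concave function on `ℝ` ("Let `F(x)` be a nonnegative function ... log concave") up to
the choice of `S = {F > 0}` and `H = −log F`. [cite: BrascampLieb1976, Thm 5.1 (the factor `F`)] -/
def logConcaveFactor (S : Set ℝ) (H : ℝ → ℝ) : ℝ → ℝ := S.indicator fun x => Real.exp (-H x)

/-- `F ≥ 0`. [cite: BrascampLieb1976, Thm 5.1 (the factor `F`)] -/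
theorem logConcaveFactor_nonneg (S : Set ℝ) (H : ℝ → ℝ) (x : ℝ) : 0 ≤ logConcaveFactor S H x := by
  unfold logConcaveFactor
  exact Set.indicator_nonneg (fun _ _ => (Real.exp_pos _).le) _

/-- `F = e^{-H}` on `S`. [cite: BrascampLieb1976, Thm 5.1 (the factor `F`)] -/
theorem logConcaveFactor_of_mem {S : Set ℝ} (H : ℝ → ℝ) {x : ℝ} (hx : x ∈ S) :
    logConcaveFactor S H x = Real.exp (-H x) := indicator_of_mem hx _

/-- `F = 0` off `S`. [cite: BrascampLieb1976, Thm 5.1 (the factor `F`)] -/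
theorem logConcaveFactor_of_notMem {S : Set ℝ} (H : ℝ → ℝ) {x : ℝ} (hx : x ∉ S) :
    logConcaveFactor S H x = 0 := indicator_of_notMem hx _

/-- Quasi-concavity of an exponentially tilted log-concave factor: for `x ≤ y ≤ z`,
`min (G x) (G z) ≤ G y` where `G u = F(u + m) e^{ℓ u + κ}`, `F = 1_S e^{-H}`, `H` convex on the
interval `S` ("Then `G(x)` is log concave" in the printed proof; this is the only use of
log-concavity in the proof of Theorem 5.1). [cite: BrascampLieb1976, Lemma 5.3 (the function `G`)] -/
theorem quasiconcave_tilt_logConcaveFactor {S : Set ℝ} (hS : S.OrdConnected) {H : ℝ → ℝ}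
    (hH : ConvexOn ℝ S H) (m ℓ κ : ℝ) {x y z : ℝ} (hxy : x ≤ y) (hyz : y ≤ z) :
    min (logConcaveFactor S H (x + m) * Real.exp (ℓ * x + κ))
      (logConcaveFactor S H (z + m) * Real.exp (ℓ * z + κ)) ≤
      logConcaveFactor S H (y + m) * Real.exp (ℓ * y + κ) := by
  have hGnn : ∀ u, 0 ≤ logConcaveFactor S H (u + m) * Real.exp (ℓ * u + κ) :=
    fun u => mul_nonneg (logConcaveFactor_nonneg S H _) (Real.exp_pos _).le
  by_cases hx : x + m ∈ S
  swap
  · rw [logConcaveFactor_of_notMem H hx, zero_mul]; exact (min_le_left _ _).trans (hGnn y)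
  by_cases hz : z + m ∈ S
  swap
  · rw [logConcaveFactor_of_notMem H hz, zero_mul]; exact (min_le_right _ _).trans (hGnn y)
  have hy : y + m ∈ S := hS.out hx hz ⟨by linarith, by linarith⟩
  rw [logConcaveFactor_of_mem H hx, logConcaveFactor_of_mem H hy, logConcaveFactor_of_mem H hz,
    ← Real.exp_add, ← Real.exp_add, ← Real.exp_add]
  -- the exponents `E u = -H(u+m) + (ℓ u + κ)`; convexity of `H` gives `E y ≥ min (E x) (E z)`
  rcases eq_or_lt_of_le (hxy.trans hyz) with hxz | hxz
  · have h1 : y = x := le_antisymm (by linarith) hxy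
    subst h1; rw [← hxz]; exact min_le_left _ _
  · set θ := (z - y) / (z - x) with hθ
    have hzx : 0 < z - x := by linarith
    have hθ0 : 0 ≤ θ := div_nonneg (by linarith) hzx.le
    have hθ1 : θ ≤ 1 := (div_le_one hzx).2 (by linarith)
    have hconv : y + m = θ • (x + m) + (1 - θ) • (z + m) := by
      simp only [smul_eq_mul]; rw [hθ]; field_simp; ring
    have hHy : H (y + m) ≤ θ • H (x + m) + (1 - θ) • H (z + m) := by
      rw [hconv]; exact hH.2 hx hz hθ0 (by linarith) (by ring)
    simp only [smul_eq_mul] at hHy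
    have hlin : ℓ * y + κ = θ * (ℓ * x + κ) + (1 - θ) * (ℓ * z + κ) := by
      rw [hθ]; field_simp; ring
    -- `E y ≥ θ E x + (1-θ) E z ≥ min (E x) (E z)`
    have hE : min (-H (x + m) + (ℓ * x + κ)) (-H (z + m) + (ℓ * z + κ)) ≤
        -H (y + m) + (ℓ * y + κ) := by
      rw [hlin]
      rcases le_total (-H (x + m) + (ℓ * x + κ)) (-H (z + m) + (ℓ * z + κ)) with h | h
      · rw [min_eq_left h]; nlinarith
      · rw [min_eq_right h]; nlinarith
    rcases le_total (-H (x + m) + (ℓ * x + κ)) (-H (z + m) + (ℓ * z + κ)) with h | h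
    · rw [min_eq_left h] at hE
      exact (min_le_left _ _).trans (Real.exp_le_exp.2 hE)
    · rw [min_eq_right h] at hE
      exact (min_le_right _ _).trans (Real.exp_le_exp.2 hE)

/-- `(u + y)^k ≤ 2^k (u^k + y^k)` for `u, y ≥ 0`. [folklore] -/
private theorem add_pow_le_two_pow_mul' {u y : ℝ} (hu : 0 ≤ u) (hy : 0 ≤ y) (k : ℕ) :
    (u + y) ^ k ≤ 2 ^ k * (u ^ k + y ^ k) := by
  rcases le_total u y with h | h
  · calc (u + y) ^ k ≤ (2 * y) ^ k := pow_le_pow_left₀ (by positivity) (by linarith) k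
      _ = 2 ^ k * y ^ k := mul_pow _ _ _
      _ ≤ 2 ^ k * (u ^ k + y ^ k) := by gcongr; linarith [pow_nonneg hu k]
  · calc (u + y) ^ k ≤ (2 * u) ^ k := pow_le_pow_left₀ (by positivity) (by linarith) k
      _ = 2 ^ k * u ^ k := mul_pow _ _ _
      _ ≤ 2 ^ k * (u ^ k + y ^ k) := by gcongr; linarith [pow_nonneg hy k]

/-- Integrability of `|x - m|^k e^{-bx²} F` from that of all `x^i e^{-bx²} F`. [folklore] -/
private theorem integrable_abs_sub_pow_mul {b : ℝ} {F : ℝ → ℝ} (hF : ∀ x, 0 ≤ F x)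
    (hint : ∀ k : ℕ, Integrable fun x => x ^ k * (Real.exp (-b * x ^ 2) * F x)) (m : ℝ) (k : ℕ) :
    Integrable fun x => |x - m| ^ k * (Real.exp (-b * x ^ 2) * F x) := by
  have hWF : AEStronglyMeasurable (fun x => Real.exp (-b * x ^ 2) * F x) volume := by
    simpa using (hint 0).aestronglyMeasurable
  have hIk : Integrable fun x => |x| ^ k * (Real.exp (-b * x ^ 2) * F x) := by
    refine (hint k).congr' ((continuous_abs.pow k).aestronglyMeasurable.mul hWF)
      (Filter.Eventually.of_forall fun x => ?_)
    simp only [Real.norm_eq_abs, abs_mul, abs_pow, abs_abs]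
  have hdom : Integrable fun x => 2 ^ k * (|x| ^ k * (Real.exp (-b * x ^ 2) * F x)) +
      2 ^ k * |m| ^ k * (Real.exp (-b * x ^ 2) * F x) :=
    (hIk.const_mul _).add ((by simpa using hint 0 : Integrable fun x =>
      Real.exp (-b * x ^ 2) * F x).const_mul _)
  refine hdom.mono' (((continuous_id.sub continuous_const).abs.pow k).aestronglyMeasurable.mul hWF)
    (Filter.Eventually.of_forall fun x => ?_)
  have hWFx : 0 ≤ Real.exp (-b * x ^ 2) * F x := mul_nonneg (Real.exp_pos _).le (hF x)
  rw [Real.norm_of_nonneg (mul_nonneg (pow_nonneg (abs_nonneg _) _) hWFx)]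
  have h1 : |x - m| ≤ |x| + |m| := abs_sub _ _
  have h2 : |x - m| ^ k ≤ 2 ^ k * (|x| ^ k + |m| ^ k) :=
    (pow_le_pow_left₀ (abs_nonneg _) h1 k).trans
      (add_pow_le_two_pow_mul' (abs_nonneg _) (abs_nonneg _) k)
  calc |x - m| ^ k * (Real.exp (-b * x ^ 2) * F x)
      ≤ 2 ^ k * (|x| ^ k + |m| ^ k) * (Real.exp (-b * x ^ 2) * F x) :=
        mul_le_mul_of_nonneg_right h2 hWFx
    _ = _ := by ring

/-! ### Theorem 5.1 (n = 1) -/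

/-- **Brascamp–Lieb 1976, Theorem 5.1 for `n = 1` (= Lemma 5.3), as printed**: let `F ≥ 0` be
log concave on `ℝ` — here `F = 1_S e^{-H}` with `S ⊆ ℝ` an interval (`OrdConnected`; bounded or
not) and `H` convex on `S` — and let `⟨h⟩_F = ∫ h e^{-bx²} F / ∫ e^{-bx²} F`, `⟨h⟩_1` the same with
`F = 1` (`b > 0`). Then for every integer `α = p ≥ 1`,
`⟨|x − ⟨x⟩_F|^p⟩_F ≤ ⟨|x|^p⟩_1`.
Hypotheses as data: all moments `x^k e^{-bx²} F(x)` integrable, `Z = ∫ e^{-bx²}F > 0`, and `m` is the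
mean (`m · Z = ∫ x e^{-bx²} F`). The printed theorem allows real `α ≥ 1` and (Thm 5.1) `ℝⁿ` with a
positive definite quadratic form; this is the case the jensen track consumes (even and odd integer
moments on an interval). [cite: BrascampLieb1976, Thm 5.1 (n = 1), Lemma 5.3, eq. (5.5)] -/
theorem centredAbsMoment_le_gaussian {b : ℝ} (hb : 0 < b) {S : Set ℝ} (hS : S.OrdConnected)
    {H : ℝ → ℝ} (hH : ConvexOn ℝ S H)
    (hint : ∀ k : ℕ, Integrable fun x => x ^ k * (Real.exp (-b * x ^ 2) * logConcaveFactor S H x))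
    (hZ : 0 < ∫ x, Real.exp (-b * x ^ 2) * logConcaveFactor S H x) {m : ℝ}
    (hm : m * ∫ x, Real.exp (-b * x ^ 2) * logConcaveFactor S H x =
      ∫ x, x * (Real.exp (-b * x ^ 2) * logConcaveFactor S H x))
    {p : ℕ} (hp : p ≠ 0) :
    (∫ x, |x - m| ^ p * (Real.exp (-b * x ^ 2) * logConcaveFactor S H x)) /
        (∫ x, Real.exp (-b * x ^ 2) * logConcaveFactor S H x) ≤
      (∫ x, |x| ^ p * Real.exp (-b * x ^ 2)) / ∫ x, Real.exp (-b * x ^ 2) := by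
  set F := logConcaveFactor S H with hFdef
  have hF : ∀ x, 0 ≤ F x := logConcaveFactor_nonneg S H
  -- the recentred, tilted factor `G(y) = F(y + m) e^{-2bm y - bm²}`, so that `w(y) G(y) = w(y+m) F(y+m)`
  set G : ℝ → ℝ := fun y => F (y + m) * Real.exp (-(2 * b * m) * y + -(b * m ^ 2)) with hGdef
  have hshift : ∀ y, Real.exp (-b * y ^ 2) * G y =
      Real.exp (-b * (y + m) ^ 2) * F (y + m) := by
    intro y
    have he : Real.exp (-b * y ^ 2) * Real.exp (-(2 * b * m) * y + -(b * m ^ 2)) =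
        Real.exp (-b * (y + m) ^ 2) := by
      rw [← Real.exp_add]; congr 1; ring
    simp only [hGdef]
    rw [← he]; ring
  have hWF : Integrable fun x => Real.exp (-b * x ^ 2) * F x := by simpa using hint 0
  -- `G` satisfies the hypotheses of the core
  have D : GaussQCData b G :=
    { nonneg := fun y => mul_nonneg (hF _) (Real.exp_pos _).le
      quasiconcave := fun x y z hxy hyz =>
        quasiconcave_tilt_logConcaveFactor hS hH m (-(2 * b * m)) (-(b * m ^ 2)) hxy hyz
      integrable := fun k => by
        have hWG : AEStronglyMeasurable (fun y => Real.exp (-b * y ^ 2) * G y) volume :=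
          (hWF.comp_add_right m).aestronglyMeasurable.congr
            (Filter.Eventually.of_forall fun y => (hshift y).symm)
        have h := (integrable_abs_sub_pow_mul hF hint m k).comp_add_right m
        -- `h : Integrable fun y => |y + m - m|^k * (w(y+m) F(y+m))`
        refine h.congr' ((continuous_id.pow k).aestronglyMeasurable.mul hWG)
          (Filter.Eventually.of_forall fun y => ?_)
        simp only [add_sub_cancel_right, hshift y, Real.norm_eq_abs, abs_mul, abs_pow, abs_abs]
      mean_zero := by
        have e : (fun y => y * (Real.exp (-b * y ^ 2) * G y)) =
            fun y => (fun x => (x - m) * (Real.exp (-b * x ^ 2) * F x)) (y + m) := by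
          funext y; simp only [add_sub_cancel_right]; rw [hshift]
        rw [e, integral_add_right_eq_self (fun x => (x - m) * (Real.exp (-b * x ^ 2) * F x)) m]
        have e2 : (fun x => (x - m) * (Real.exp (-b * x ^ 2) * F x)) =
            fun x => x * (Real.exp (-b * x ^ 2) * F x) - m * (Real.exp (-b * x ^ 2) * F x) := by
          funext x; ring
        rw [e2, integral_sub (by simpa using hint 1) (hWF.const_mul m), integral_const_mul, ← hm,
          sub_self] }
  -- the core inequality for `G`, transported back
  have hcore := D.core hb hp
  have e1 : ∫ y, |y| ^ p * (Real.exp (-b * y ^ 2) * G y) =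
      ∫ x, |x - m| ^ p * (Real.exp (-b * x ^ 2) * F x) := by
    rw [← integral_add_right_eq_self (fun x => |x - m| ^ p * (Real.exp (-b * x ^ 2) * F x)) m]
    congr 1; funext y; simp only [add_sub_cancel_right]; rw [hshift]
  have e2 : ∫ y, Real.exp (-b * y ^ 2) * G y = ∫ x, Real.exp (-b * x ^ 2) * F x := by
    rw [← integral_add_right_eq_self (fun x => Real.exp (-b * x ^ 2) * F x) m]
    congr 1; funext y; rw [hshift]
  rw [e1, e2] at hcore
  rw [integral_abs_pow_mul_gauss, integral_gauss_eq_two_mul,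
    mul_div_mul_left _ _ (two_ne_zero), div_le_div_iff₀ hZ (gaussHalfMoment_pos hb 0)]
  linarith

/-- The Gaussian absolute moment ratio in closed form:
`⟨|x|^p⟩₁ = ∫|x|^p e^{-bx²} / ∫ e^{-bx²} = b^{-p/2} Γ((p+1)/2)/√π`.
[cite: GradshteynRyzhik2015, 3.326.2 and 3.321.3] -/
theorem gaussAbsMoment_ratio_eq {b : ℝ} (hb : 0 < b) (p : ℕ) :
    (∫ x, |x| ^ p * Real.exp (-b * x ^ 2)) / (∫ x, Real.exp (-b * x ^ 2)) =
      b ^ (-((p : ℝ) / 2)) * Real.Gamma (((p : ℝ) + 1) / 2) / √π := by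
  rw [integral_abs_pow_mul_gauss, integral_gaussian, gaussHalfMoment_eq hb,
    Real.sqrt_div' _ hb.le]  -- `√(π/b) = √π/√b`
  have hsb : √b = b ^ ((1:ℝ) / 2) := Real.sqrt_eq_rpow b
  have hsplit : b ^ (-((p:ℝ) / 2)) = b ^ (-(((p : ℝ) + 1) / 2)) * b ^ ((1:ℝ) / 2) := by
    rw [← Real.rpow_add hb]; congr 1; ring
  rw [hsb, hsplit]
  have hπ : 0 < √π := Real.sqrt_pos.2 Real.pi_pos
  have hb2 : 0 < b ^ ((1:ℝ) / 2) := Real.rpow_pos_of_pos hb _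
  field_simp

/-- Even moments: `∫ x^{2j} e^{-bx²} / ∫ e^{-bx²} = (2j−1)‼ / (2b)^j` (the variance is `1/(2b)`).
[cite: GradshteynRyzhik2015, 3.461.2] -/
theorem gaussEvenMoment_ratio_eq {b : ℝ} (hb : 0 < b) (j : ℕ) :
    (∫ x, |x| ^ (2 * j) * Real.exp (-b * x ^ 2)) / (∫ x, Real.exp (-b * x ^ 2)) =
      ((2 * j - 1 : ℕ)‼ : ℝ) / (2 * b) ^ j := by
  rw [gaussAbsMoment_ratio_eq hb]
  have hπ : 0 < √π := Real.sqrt_pos.2 Real.pi_pos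
  have e1 : (((2 * j : ℕ) : ℝ) + 1) / 2 = (j : ℝ) + 1 / 2 := by push_cast; ring
  have e2 : -(((2 * j : ℕ) : ℝ) / 2) = -(j : ℝ) := by push_cast; ring
  rw [e1, e2, Real.Gamma_nat_add_half, Real.rpow_neg hb.le, Real.rpow_natCast, mul_pow]
  field_simp

/-! ### The consumer form: densities `e^{-g}` on an interval with `g − (ρ/2)x²` convex -/

/-- **Gaussian domination of centred moments for strongly log-concave laws on an interval**
(Brascamp–Lieb Thm 5.1, `n = 1`, in potential form): if `S ⊆ ℝ` is an interval, `ρ > 0` and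
`g − (ρ/2) x²` is convex on `S` (for `C²` potentials: `g'' ≥ ρ` on `S`), then for the probability
law `∝ 1_S e^{-g}` with mean `m` and every integer `p ≥ 1`:
`∫_S |x − m|^p e^{-g} / ∫_S e^{-g} ≤ E|N(0, 1/ρ)|^p = ∫|x|^p e^{-ρx²/2} / ∫ e^{-ρx²/2}`.
[cite: BrascampLieb1976, Thm 5.1 (n = 1)] -/
theorem centredAbsMoment_le_gaussian_of_convexOn {ρ : ℝ} (hρ : 0 < ρ) {S : Set ℝ}
    (hS : S.OrdConnected) {g : ℝ → ℝ} (hg : ConvexOn ℝ S fun x => g x - ρ / 2 * x ^ 2)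
    (hint : ∀ k : ℕ, IntegrableOn (fun x => x ^ k * Real.exp (-g x)) S)
    (hZ : 0 < ∫ x in S, Real.exp (-g x)) {m : ℝ}
    (hm : m * ∫ x in S, Real.exp (-g x) = ∫ x in S, x * Real.exp (-g x)) {p : ℕ} (hp : p ≠ 0) :
    (∫ x in S, |x - m| ^ p * Real.exp (-g x)) / (∫ x in S, Real.exp (-g x)) ≤
      (∫ x, |x| ^ p * Real.exp (-(ρ / 2) * x ^ 2)) / ∫ x, Real.exp (-(ρ / 2) * x ^ 2) := by
  have hb : 0 < ρ / 2 := by positivity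
  have hSm : MeasurableSet S := hS.measurableSet
  set H : ℝ → ℝ := fun x => g x - ρ / 2 * x ^ 2 with hH
  -- `e^{-(ρ/2)x²} · 1_S e^{-H} = 1_S e^{-g}`
  have key : ∀ x, Real.exp (-(ρ / 2) * x ^ 2) * logConcaveFactor S H x =
      S.indicator (fun x => Real.exp (-g x)) x := by
    intro x
    by_cases hx : x ∈ S
    · rw [logConcaveFactor_of_mem H hx, indicator_of_mem hx, ← Real.exp_add]
      congr 1; simp only [hH]; ring
    · rw [logConcaveFactor_of_notMem H hx, indicator_of_notMem hx, mul_zero]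
  have hI : ∀ (h : ℝ → ℝ), (∫ x in S, h x * Real.exp (-g x)) =
      ∫ x, h x * (Real.exp (-(ρ / 2) * x ^ 2) * logConcaveFactor S H x) := by
    intro h
    rw [← integral_indicator hSm]
    congr 1; funext x
    rw [key]
    by_cases hx : x ∈ S
    · simp [indicator_of_mem hx]
    · simp [indicator_of_notMem hx]
  have hI0 : (∫ x in S, Real.exp (-g x)) =
      ∫ x, Real.exp (-(ρ / 2) * x ^ 2) * logConcaveFactor S H x := by
    simpa using hI (fun _ => 1)
  have hint' : ∀ k : ℕ, Integrable fun x => x ^ k *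
      (Real.exp (-(ρ / 2) * x ^ 2) * logConcaveFactor S H x) := by
    intro k
    have h := (hint k).integrable_indicator hSm
    refine h.congr (Filter.Eventually.of_forall fun x => ?_)
    change S.indicator (fun x => x ^ k * Real.exp (-g x)) x =
      x ^ k * (Real.exp (-(ρ / 2) * x ^ 2) * logConcaveFactor S H x)
    rw [key]
    by_cases hx : x ∈ S
    · simp [indicator_of_mem hx]
    · simp [indicator_of_notMem hx]
  have h := centredAbsMoment_le_gaussian hb hS hg hint' (by rwa [← hI0]) (m := m)
    (by rw [← hI0, ← hI (fun x => x)]; exact hm) hp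
  rwa [← hI0, ← hI (fun x => |x - m| ^ p)] at h

/-- The consumer form with the Gaussian absolute moment in closed form:
`∫_S |x − m|^p e^{-g} / ∫_S e^{-g} ≤ (ρ/2)^{-p/2} Γ((p+1)/2)/√π = g_p ρ^{-p/2}` with
`g_p = 2^{p/2} Γ((p+1)/2)/√π = E|N(0,1)|^p` (`g_3 = 1.5957…`, `g_5 = 6.383…`, `g_7 = 38.29…`).
[cite: BrascampLieb1976, Thm 5.1 (n = 1)] -/
theorem centredAbsMoment_le_gaussAbsMoment {ρ : ℝ} (hρ : 0 < ρ) {S : Set ℝ}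
    (hS : S.OrdConnected) {g : ℝ → ℝ} (hg : ConvexOn ℝ S fun x => g x - ρ / 2 * x ^ 2)
    (hint : ∀ k : ℕ, IntegrableOn (fun x => x ^ k * Real.exp (-g x)) S)
    (hZ : 0 < ∫ x in S, Real.exp (-g x)) {m : ℝ}
    (hm : m * ∫ x in S, Real.exp (-g x) = ∫ x in S, x * Real.exp (-g x)) {p : ℕ} (hp : p ≠ 0) :
    (∫ x in S, |x - m| ^ p * Real.exp (-g x)) / (∫ x in S, Real.exp (-g x)) ≤
      (ρ / 2) ^ (-((p : ℝ) / 2)) * Real.Gamma (((p : ℝ) + 1) / 2) / √π := by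
  have h := centredAbsMoment_le_gaussian_of_convexOn hρ hS hg hint hZ hm hp
  rwa [gaussAbsMoment_ratio_eq (by positivity : 0 < ρ / 2)] at h

/-- **The sharp even-moment ladder** used by the jensen track (`c_{2j} = (2j−1)‼`): under the
hypotheses of `centredAbsMoment_le_gaussian_of_convexOn`,
`∫_S (x − m)^{2j} e^{-g} / ∫_S e^{-g} ≤ (2j − 1)‼ / ρ^j`. [cite: BrascampLieb1976, Thm 5.1 (n = 1)] -/
theorem centredEvenMoment_le_doubleFactorial {ρ : ℝ} (hρ : 0 < ρ) {S : Set ℝ}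
    (hS : S.OrdConnected) {g : ℝ → ℝ} (hg : ConvexOn ℝ S fun x => g x - ρ / 2 * x ^ 2)
    (hint : ∀ k : ℕ, IntegrableOn (fun x => x ^ k * Real.exp (-g x)) S)
    (hZ : 0 < ∫ x in S, Real.exp (-g x)) {m : ℝ}
    (hm : m * ∫ x in S, Real.exp (-g x) = ∫ x in S, x * Real.exp (-g x)) {j : ℕ} (hj : j ≠ 0) :
    (∫ x in S, (x - m) ^ (2 * j) * Real.exp (-g x)) / (∫ x in S, Real.exp (-g x)) ≤
      ((2 * j - 1 : ℕ)‼ : ℝ) / ρ ^ j := by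
  have h := centredAbsMoment_le_gaussian_of_convexOn hρ hS hg hint hZ hm (p := 2 * j)
    (Nat.mul_ne_zero two_ne_zero hj)
  rw [gaussEvenMoment_ratio_eq (by positivity : 0 < ρ / 2)] at h
  have e : (2 * (ρ / 2)) ^ j = ρ ^ j := by congr 1; ring
  rw [e] at h
  refine le_trans (le_of_eq ?_) h
  congr 1
  refine integral_congr_ae (Filter.Eventually.of_forall fun x => ?_)
  simp only [Even.pow_abs (even_two_mul j)]

end Literature.Probability.Distributions
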